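import Summits.Ventures.Crystal3D.Theorems.StickyWulffConstantGenericWallFloorExactOnly
import Summits.Ventures.Crystal3D.Theorems.StickyWulffConstantGenericWallFloorCapStartBarlowStep
import Summits.Ventures.Crystal3D.Theorems.StickyWulffConstantGenericWallFloorInPlaneTwinStarPairTools
import HarnessLib

/-!
# The h-LAYER ROW WALK: the cap-free in-plane machine on anticuboctahedral (h-type) material
# (crux `GenericWallFloor`, stmt-Ventures-19480, kernel G; consumer lane T EDGE-ON flux class, line «LAYER ROWS» of cf-p1 RULING (ccix) 2026-08-29,
#  item (R1) as corrected by the machine owner's check HOME/wall-p2-g13/LAYER-ROWS-R1-CHECK.md: the cap-free rule is sound EXACTLY on h-layers)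

HONEST FRAMING. Venture `Summits/Ventures/Crystal3D` (cell `crystal3d-full`), route `route-Ventures-StickyWulffConstant`, helper for the crux
`GenericWallFloor` (stmt-Ventures-19480) / consumer `TextureLiminfV5` (stmt-Ventures-23912).  Definitions + elementary lemmas; standard axioms; the
certificate of the equatorial closed star (E1h, orbit A12-583) is taken BY NAME, at the ball; nothing about any wall law is claimed; F-C1 not moved.

THE POINT.  Lane G's stack walk (`walkStep`) steps straight only from a ball that is FULL in an fcc frame; on an h-LAYER `m` of a plate (word letters
`s(m−1) ≠ s(m)`) every ball's lattice dozen is the ANTICUBOCTAHEDRON `y + F·hcpSlots` (`hcpSlots` = the six in-plane slots, the upper triple, and the BASAL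
MIRROR of the upper triple), so no in-layer row family exists there.  This file is the missing machine:
* `hcpSlots`, `mem_hcpSlots`, `norm_eq_one_of_mem_hcpSlots`, `add_mem_hcpSlots_of_inner` (a star vector plus the direction is again an h-slot);
* **`hRowStep X F u y`** — from `y`, step to `y + F u` iff ALL TWELVE sites `y + F·hcpSlots` are occupied; else `none` (END).  No caps, no stack: by the
  owner's enumeration the closed star of the in-plane arrival slot in the anticuboctahedron lies in exactly ONE close-packed dozen (SingleDozen holds),
  whereas at c-type balls it lies in three (own + two inclined twin caps — there the stack walk is the right machine);
* `hRowRun`, **`HRowInv X F u y`** (`y ∈ X`, the predecessor `y − F u ∈ X` is h-FULL) and its preservation `hRowInv_step`;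
* `hRow_owns_star` — under the invariant `y` owns the closed star `{y + F s : s ∈ hcpSlots, ⟪s, −u⟫ > 0}` of its arrival slot;
* **`hRow_end_le_eleven`** — END ⇒ `≤ 11` contacts, from `ExactOnly` + `SingleDozen` of that star AT `y` (`unsaturated_of_exactOnly'`, E2), packaged as
  the named per-run hypothesis **`HStarCertifiedAt F u`** (to be discharged from ONE model certificate by transport + the hand lemma, next files);
* `hRowRun_spec` (invariant along the run, position `y + n • F u`), **`hRow_end`** — the run with enough fuel stops, at a ball of `X` with `≤ 11` contacts,
  `n` steps `F u` from the start.
WHAT THIS IS NOT: no certificate (E1h is a named hypothesis), no transport, no line count / launch (the K1a-at glue `barlow_layerRows_inPlane_at` is the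
sequel), nothing on c-layers (the stack walk); F-C1 not moved.
-/

noncomputable section

namespace Summit.Ventures.Crystal3D.Theorems

open Finset
open Literature.MathematicalPhysics.StatisticalMechanics (basalMirror basalMirror_apply_coord)
open scoped InnerProductSpace

variable {X : Finset (EuclideanSpace ℝ (Fin 3))}

/-! ### The anticuboctahedral slot dozen -/

/-- The nine slots of `Λ₀` on or above the basal plane: the in-plane hexagon and the upper triple. -/
def upperSlots : Finset (EuclideanSpace ℝ (Fin 3)) := fccSlots.filter fun w => 0 ≤ w 2

/-- **The h-type (anticuboctahedral) dozen** in model coordinates: the hexagon, the upper triple, and the BASAL MIRROR image of the upper triple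
(the dozen of every site of an h-layer of a Barlow stacking, in the layer's frame). -/
def hcpSlots : Finset (EuclideanSpace ℝ (Fin 3)) := upperSlots ∪ upperSlots.image basalMirror

/-- Pairing with an in-plane vector is blind to the basal mirror. -/
theorem inner_basalMirror_of_inPlane (t : EuclideanSpace ℝ (Fin 3)) {u : EuclideanSpace ℝ (Fin 3)} (hu : u 2 = 0) :
    ⟪basalMirror t, u⟫_ℝ = ⟪t, u⟫_ℝ := by
  conv_lhs => rw [← basalMirror_of_inPlane hu]
  rw [LinearIsometryEquiv.inner_map_map]

/-- Membership in `upperSlots`. -/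
theorem mem_upperSlots {w : EuclideanSpace ℝ (Fin 3)} : w ∈ upperSlots ↔ w ∈ fccSlots ∧ 0 ≤ w 2 := by
  rw [upperSlots, mem_filter]

/-- Membership in `hcpSlots`: an upper slot, or the basal mirror of one. -/
theorem mem_hcpSlots {s : EuclideanSpace ℝ (Fin 3)} :
    s ∈ hcpSlots ↔ (s ∈ fccSlots ∧ 0 ≤ s 2) ∨ ∃ t, (t ∈ fccSlots ∧ 0 ≤ t 2) ∧ basalMirror t = s := by
  rw [hcpSlots, mem_union, mem_upperSlots, mem_image]
  simp only [mem_upperSlots]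

/-- Upper slots are h-slots. -/
theorem mem_hcpSlots_of_upper {w : EuclideanSpace ℝ (Fin 3)} (hw : w ∈ fccSlots) (h2 : 0 ≤ w 2) : w ∈ hcpSlots :=
  mem_hcpSlots.2 (Or.inl ⟨hw, h2⟩)

/-- Mirrors of upper slots are h-slots. -/
theorem basalMirror_mem_hcpSlots_of_upper {w : EuclideanSpace ℝ (Fin 3)} (hw : w ∈ fccSlots) (h2 : 0 ≤ w 2) :
    basalMirror w ∈ hcpSlots :=
  mem_hcpSlots.2 (Or.inr ⟨w, ⟨hw, h2⟩, rfl⟩)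

/-- In-plane slots are h-slots. -/
theorem mem_hcpSlots_of_inPlane {u : EuclideanSpace ℝ (Fin 3)} (hu : u ∈ fccSlots) (hu2 : u 2 = 0) : u ∈ hcpSlots :=
  mem_hcpSlots_of_upper hu hu2.symm.le

/-- Every h-slot is a unit vector. -/
theorem norm_eq_one_of_mem_hcpSlots {s : EuclideanSpace ℝ (Fin 3)} (hs : s ∈ hcpSlots) : ‖s‖ = 1 := by
  rcases mem_hcpSlots.1 hs with ⟨hs', -⟩ | ⟨t, ⟨ht, -⟩, rfl⟩
  · exact norm_eq_one_of_mem_fccSlots hs'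
  · rw [LinearIsometryEquiv.norm_map]; exact norm_eq_one_of_mem_fccSlots ht

/-- The slot menu for an h-slot against an IN-PLANE slot: `⟪s, u⟫ ∈ {1, ½, 0, −½, −1}`. -/
theorem inner_hcpSlots_inPlane_mem {s u : EuclideanSpace ℝ (Fin 3)} (hs : s ∈ hcpSlots) (hu : u ∈ fccSlots) (hu2 : u 2 = 0) :
    ⟪s, u⟫_ℝ = 1 ∨ ⟪s, u⟫_ℝ = 1 / 2 ∨ ⟪s, u⟫_ℝ = 0 ∨ ⟪s, u⟫_ℝ = -(1 / 2) ∨ ⟪s, u⟫_ℝ = -1 := by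
  rcases mem_hcpSlots.1 hs with ⟨hs', -⟩ | ⟨t, ⟨ht, -⟩, rfl⟩
  · exact inner_slots_mem hs' hu
  · rw [inner_basalMirror_of_inPlane t hu2]; exact inner_slots_mem ht hu

/-- **A star vector plus the direction is an h-slot**: `s ∈ hcpSlots`, `u` an in-plane slot, `⟪s, u⟫ = −½` ⇒ `s + u ∈ hcpSlots` (the predecessor's dozen
contains the closed star of the arrival slot: adding a layer vector keeps the hollow type). -/
theorem add_mem_hcpSlots_of_inner {s u : EuclideanSpace ℝ (Fin 3)} (hs : s ∈ hcpSlots) (hu : u ∈ fccSlots) (hu2 : u 2 = 0)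
    (h : ⟪s, u⟫_ℝ = -(1 / 2)) : s + u ∈ hcpSlots := by
  have hnu : -u ∈ fccSlots := neg_mem_fccSlots hu
  have key : ∀ {t : EuclideanSpace ℝ (Fin 3)}, t ∈ fccSlots → 0 ≤ t 2 → ⟪t, u⟫_ℝ = -(1 / 2) → t + u ∈ fccSlots ∧ 0 ≤ (t + u) 2 := by
    intro t ht ht2 htu
    have h1 : ⟪t, -u⟫_ℝ = 1 / 2 := by rw [inner_neg_right, htu, neg_neg]
    have h2 := sub_mem_fccSlots_of_inner_eq_half ht hnu h1
    rw [sub_neg_eq_add] at h2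
    exact ⟨h2, by rw [PiLp.add_apply, hu2, add_zero]; exact ht2⟩
  rcases mem_hcpSlots.1 hs with ⟨hs', hs2⟩ | ⟨t, ⟨ht, ht2⟩, rfl⟩
  · obtain ⟨h1, h2⟩ := key hs' hs2 h
    exact mem_hcpSlots_of_upper h1 h2
  · rw [inner_basalMirror_of_inPlane t hu2] at h
    obtain ⟨h1, h2⟩ := key ht ht2 h
    have : basalMirror t + u = basalMirror (t + u) := by
      rw [map_add, basalMirror_of_inPlane hu2]
    rw [this]
    exact basalMirror_mem_hcpSlots_of_upper h1 h2

/-! ### The machine -/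

/-- **ONE STEP of the h-layer row walk** in the frame `F` along the in-plane slot `u`: from `y`, move to `y + F u` iff the whole anticuboctahedral dozen
`y + F·hcpSlots` is occupied; otherwise the walker ENDS (`none`). -/
def hRowStep (X : Finset (EuclideanSpace ℝ (Fin 3))) (F : EuclideanSpace ℝ (Fin 3) ≃ₗᵢ[ℝ] EuclideanSpace ℝ (Fin 3))
    (u y : EuclideanSpace ℝ (Fin 3)) : Option (EuclideanSpace ℝ (Fin 3)) := by
  classical
  exact if ∀ w ∈ hcpSlots, y + F w ∈ X then some (y + F u) else none

/-- The h-row run with `k` steps of fuel (it stays put once it has stopped). -/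
def hRowRun (X : Finset (EuclideanSpace ℝ (Fin 3))) (F : EuclideanSpace ℝ (Fin 3) ≃ₗᵢ[ℝ] EuclideanSpace ℝ (Fin 3))
    (u : EuclideanSpace ℝ (Fin 3)) : ℕ → EuclideanSpace ℝ (Fin 3) → EuclideanSpace ℝ (Fin 3)
  | 0, y => y
  | k + 1, y => match hRowStep X F u y with
    | none => y
    | some y' => hRowRun X F u k y'

/-- **The h-row invariant**: the walker's ball is in `X` and its PREDECESSOR `y − F u` is in `X` and h-FULL (all twelve sites of its anticuboctahedral
dozen occupied) — so `y` owns the closed star of its arrival slot `−u` (pattern A12-583). -/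
def HRowInv (X : Finset (EuclideanSpace ℝ (Fin 3))) (F : EuclideanSpace ℝ (Fin 3) ≃ₗᵢ[ℝ] EuclideanSpace ℝ (Fin 3))
    (u y : EuclideanSpace ℝ (Fin 3)) : Prop :=
  y ∈ X ∧ y - F u ∈ X ∧ ∀ w ∈ hcpSlots, y - F u + F w ∈ X

/-- **E1h AT THE BALLS of one run** (named hypothesis): for the frame `F` and direction `u`, at every centre `y` the closed star
`{y + F s : s ∈ hcpSlots, ⟪s, −u⟫ > 0}` is EXACT-ONLY and SINGLE-DOZEN for the dozen `y + F·hcpSlots`.  Discharged from ONE model certificate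
(`ExactOnly 0 (hcpSlots.filter (0 < ⟪·, −u₀⟫))`, orbit A12-583 of the own-5 census) by transport under the symmetries of `hcpSlots` and the hand lemma
«the equatorial closed star lies in one close-packed dozen» (sequel files). -/
def HStarCertifiedAt (F : EuclideanSpace ℝ (Fin 3) ≃ₗᵢ[ℝ] EuclideanSpace ℝ (Fin 3)) (u : EuclideanSpace ℝ (Fin 3)) : Prop :=
  ∀ y : EuclideanSpace ℝ (Fin 3),
    ExactOnly y ((hcpSlots.filter fun s => 0 < ⟪s, -u⟫_ℝ).image fun s => y + F s) ∧
      SingleDozen y (hcpSlots.image fun s => y + F s) ((hcpSlots.filter fun s => 0 < ⟪s, -u⟫_ℝ).image fun s => y + F s)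

/-! ### Unfolding the step -/

/-- A full ball steps. -/
theorem hRowStep_of_full (F : EuclideanSpace ℝ (Fin 3) ≃ₗᵢ[ℝ] EuclideanSpace ℝ (Fin 3)) {u y : EuclideanSpace ℝ (Fin 3)}
    (h : ∀ w ∈ hcpSlots, y + F w ∈ X) : hRowStep X F u y = some (y + F u) := by
  unfold hRowStep; rw [if_pos h]

/-- A non-full ball ends. -/
theorem hRowStep_of_not_full (F : EuclideanSpace ℝ (Fin 3) ≃ₗᵢ[ℝ] EuclideanSpace ℝ (Fin 3)) {u y : EuclideanSpace ℝ (Fin 3)}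
    (h : ¬ ∀ w ∈ hcpSlots, y + F w ∈ X) : hRowStep X F u y = none := by
  unfold hRowStep; rw [if_neg h]

/-- The step, when it happens, goes to `y + F u`. -/
theorem hRowStep_eq_some_iff (F : EuclideanSpace ℝ (Fin 3) ≃ₗᵢ[ℝ] EuclideanSpace ℝ (Fin 3)) {u y y' : EuclideanSpace ℝ (Fin 3)} :
    hRowStep X F u y = some y' ↔ (∀ w ∈ hcpSlots, y + F w ∈ X) ∧ y' = y + F u := by
  by_cases h : ∀ w ∈ hcpSlots, y + F w ∈ X
  · rw [hRowStep_of_full F h]; simp only [Option.some.injEq]; exact ⟨fun h' => ⟨h, h'.symm⟩, fun h' => h'.2.symm⟩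
  · rw [hRowStep_of_not_full F h]; simp only [reduceCtorEq, false_iff, not_and]; exact fun h' => absurd h' h

/-- An END is a non-full ball. -/
theorem not_full_of_hRowStep_eq_none (F : EuclideanSpace ℝ (Fin 3) ≃ₗᵢ[ℝ] EuclideanSpace ℝ (Fin 3)) {u y : EuclideanSpace ℝ (Fin 3)}
    (h : hRowStep X F u y = none) : ∃ w ∈ hcpSlots, y + F w ∉ X := by
  by_contra hne
  push Not at hne
  rw [hRowStep_of_full F hne] at h
  exact Option.some_ne_none _ h

/-! ### The invariant -/

/-- **The invariant survives a step.** -/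
theorem hRowInv_step {F : EuclideanSpace ℝ (Fin 3) ≃ₗᵢ[ℝ] EuclideanSpace ℝ (Fin 3)} {u y : EuclideanSpace ℝ (Fin 3)}
    (hu : u ∈ fccSlots) (hu2 : u 2 = 0) (hI : HRowInv X F u y) (hfull : ∀ w ∈ hcpSlots, y + F w ∈ X) : HRowInv X F u (y + F u) := by
  refine ⟨hfull u (mem_hcpSlots_of_inPlane hu hu2), by rw [add_sub_cancel_right]; exact hI.1, fun w hw => ?_⟩
  rw [add_sub_cancel_right]; exact hfull w hw

/-- **Under the invariant the walker owns the closed star of its arrival slot**: `y + F s ∈ X` for every `s ∈ hcpSlots` with `⟪s, −u⟫ > 0`. -/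
theorem hRow_owns_star {F : EuclideanSpace ℝ (Fin 3) ≃ₗᵢ[ℝ] EuclideanSpace ℝ (Fin 3)} {u y : EuclideanSpace ℝ (Fin 3)}
    (hu : u ∈ fccSlots) (hu2 : u 2 = 0) (hI : HRowInv X F u y) {s : EuclideanSpace ℝ (Fin 3)} (hs : s ∈ hcpSlots)
    (hpos : 0 < ⟪s, -u⟫_ℝ) : y + F s ∈ X := by
  obtain ⟨-, hpred, hfull⟩ := hI
  have hsu : ⟪s, u⟫_ℝ < 0 := by rw [inner_neg_right] at hpos; linarith
  rcases inner_hcpSlots_inPlane_mem hs hu hu2 with h | h | h | h | h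
  · linarith
  · linarith
  · linarith
  · -- `⟪s, u⟫ = −½`: the star ball is the predecessor's h-slot `s + u`
    have hmem := add_mem_hcpSlots_of_inner hs hu hu2 h
    have := hfull (s + u) hmem
    rwa [map_add, show y - F u + (F s + F u) = y + F s by abel] at this
  · -- `⟪s, u⟫ = −1`: `s = −u`, the star ball is the predecessor itself
    have hs1 := eq_neg_of_inner_eq_neg_one'' (norm_eq_one_of_mem_hcpSlots hs) (norm_eq_one_of_mem_fccSlots hu) h
    rw [hs1, map_neg, ← sub_eq_add_neg]; exact hpred

/-- **END ⇒ PAYS**: under the invariant, a ball at which the h-row walk stops has at most eleven contacts — given the A12-583 certificate AT `y`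
(`ExactOnly` and `SingleDozen` of the closed star of the arrival slot in the dozen `y + F·hcpSlots`). -/
theorem hRow_end_le_eleven (hX : ∀ p ∈ X, ∀ q ∈ X, p ≠ q → 1 ≤ dist p q)
    {F : EuclideanSpace ℝ (Fin 3) ≃ₗᵢ[ℝ] EuclideanSpace ℝ (Fin 3)} {u y : EuclideanSpace ℝ (Fin 3)}
    (hu : u ∈ fccSlots) (hu2 : u 2 = 0) (hI : HRowInv X F u y) (hstop : hRowStep X F u y = none)
    (hE : ExactOnly y ((hcpSlots.filter fun s => 0 < ⟪s, -u⟫_ℝ).image fun s => y + F s))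
    (hS : SingleDozen y (hcpSlots.image fun s => y + F s) ((hcpSlots.filter fun s => 0 < ⟪s, -u⟫_ℝ).image fun s => y + F s)) :
    (X.filter fun q => dist y q = 1).card ≤ 11 := by
  classical
  refine unsaturated_of_exactOnly' X hX y (hcpSlots.image fun s => y + F s) _ ?_ hE hS ?_
  · intro q hq
    obtain ⟨s, hs, rfl⟩ := mem_image.1 hq
    obtain ⟨hs', hpos⟩ := mem_filter.1 hs
    refine mem_filter.2 ⟨hRow_owns_star hu hu2 hI hs' hpos, ?_⟩
    rw [dist_eq_norm, sub_add_cancel_left, norm_neg, LinearIsometryEquiv.norm_map, norm_eq_one_of_mem_hcpSlots hs']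
  · obtain ⟨w, hw, hwX⟩ := not_full_of_hRowStep_eq_none F hstop
    exact ⟨y + F w, mem_image.2 ⟨w, hw, rfl⟩, hwX⟩

/-! ### The run -/

/-- Fuel `0`. -/
@[simp] theorem hRowRun_zero (F : EuclideanSpace ℝ (Fin 3) ≃ₗᵢ[ℝ] EuclideanSpace ℝ (Fin 3)) (u y : EuclideanSpace ℝ (Fin 3)) :
    hRowRun X F u 0 y = y := rfl

/-- One more unit of fuel, unfolded at the START. -/
theorem hRowRun_succ (F : EuclideanSpace ℝ (Fin 3) ≃ₗᵢ[ℝ] EuclideanSpace ℝ (Fin 3)) (u : EuclideanSpace ℝ (Fin 3)) (k : ℕ)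
    (y : EuclideanSpace ℝ (Fin 3)) :
    hRowRun X F u (k + 1) y = match hRowStep X F u y with | none => y | some y' => hRowRun X F u k y' := rfl

/-- A stopped walker stays put. -/
theorem hRowRun_of_none (F : EuclideanSpace ℝ (Fin 3) ≃ₗᵢ[ℝ] EuclideanSpace ℝ (Fin 3)) {u y : EuclideanSpace ℝ (Fin 3)}
    (h : hRowStep X F u y = none) (k : ℕ) : hRowRun X F u k y = y := by
  cases k with
  | zero => rfl
  | succ k => rw [hRowRun_succ, h]

/-- A full walker steps and continues. -/
theorem hRowRun_succ_of_full (F : EuclideanSpace ℝ (Fin 3) ≃ₗᵢ[ℝ] EuclideanSpace ℝ (Fin 3)) {u y : EuclideanSpace ℝ (Fin 3)}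
    (h : ∀ w ∈ hcpSlots, y + F w ∈ X) (k : ℕ) : hRowRun X F u (k + 1) y = hRowRun X F u k (y + F u) := by
  rw [hRowRun_succ, hRowStep_of_full F h]

/-- **The run preserves the invariant, moves by a natural multiple of `F u`, and after the fuel is spent has either stopped or used every unit**:
`hRowRun k y = y + n • F u` with `n ≤ k`, `HRowInv` there, and (`n = k` or the walk has stopped). -/
theorem hRowRun_spec {F : EuclideanSpace ℝ (Fin 3) ≃ₗᵢ[ℝ] EuclideanSpace ℝ (Fin 3)} {u : EuclideanSpace ℝ (Fin 3)}
    (hu : u ∈ fccSlots) (hu2 : u 2 = 0) (k : ℕ) {y : EuclideanSpace ℝ (Fin 3)} (hI : HRowInv X F u y) :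
    ∃ n : ℕ, n ≤ k ∧ hRowRun X F u k y = y + (n : ℝ) • F u ∧ HRowInv X F u (hRowRun X F u k y) ∧
      (n = k ∨ hRowStep X F u (hRowRun X F u k y) = none) := by
  induction k generalizing y with
  | zero => exact ⟨0, le_rfl, by simp, hI, Or.inl rfl⟩
  | succ k IH =>
    by_cases hfull : ∀ w ∈ hcpSlots, y + F w ∈ X
    · obtain ⟨n, hn, hrun, hInv, hend⟩ := IH (hRowInv_step hu hu2 hI hfull)
      refine ⟨n + 1, by omega, ?_, ?_, ?_⟩
      · rw [hRowRun_succ_of_full F hfull, hrun, Nat.cast_succ, add_smul, one_smul]; abel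
      · rw [hRowRun_succ_of_full F hfull]; exact hInv
      · rw [hRowRun_succ_of_full F hfull]
        rcases hend with h | h
        · exact Or.inl (by omega)
        · exact Or.inr h
    · have hnone := hRowStep_of_not_full F hfull (u := u)
      refine ⟨0, Nat.zero_le _, ?_, ?_, Or.inr ?_⟩
      · rw [hRowRun_of_none F hnone]; simp
      · rw [hRowRun_of_none F hnone]; exact hI
      · rw [hRowRun_of_none F hnone]; exact hnone

/-- **THE END OF AN h-ROW.**  `X` `1`-separated and below height `H` along a unit vector `z`; the direction rises: `⟪F u, z⟫ ≥ r > 0`; the invariant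
holds at the start `y`; the A12-583 certificate holds at the balls (`HStarCertifiedAt F u`); fuel `N` with `r·N > H − ⟪y, z⟫` (any real `r ≤ ⟪F u, z⟫`).  Then the run has STOPPED at
a ball of `X` with AT MOST ELEVEN contacts, `n ≤ N` steps `F u` from `y` (so it rose by `n·⟪F u, z⟫`). -/
theorem hRow_end (hX : ∀ p ∈ X, ∀ q ∈ X, p ≠ q → 1 ≤ dist p q)
    {F : EuclideanSpace ℝ (Fin 3) ≃ₗᵢ[ℝ] EuclideanSpace ℝ (Fin 3)} {u : EuclideanSpace ℝ (Fin 3)} (hu : u ∈ fccSlots) (hu2 : u 2 = 0)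
    (hcert : HStarCertifiedAt F u) {z : EuclideanSpace ℝ (Fin 3)} {r H : ℝ} (hrise : r ≤ ⟪F u, z⟫_ℝ)
    (hH : ∀ p ∈ X, ⟪p, z⟫_ℝ ≤ H) {y : EuclideanSpace ℝ (Fin 3)} (hI : HRowInv X F u y) {N : ℕ} (hN : H - ⟪y, z⟫_ℝ < r * N) :
    ∃ n : ℕ, n ≤ N ∧ hRowRun X F u N y = y + (n : ℝ) • F u ∧ hRowRun X F u N y ∈ X ∧
      hRowStep X F u (hRowRun X F u N y) = none ∧ (X.filter fun q => dist (hRowRun X F u N y) q = 1).card ≤ 11 := by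
  obtain ⟨n, hn, hrun, hInv, hend⟩ := hRowRun_spec hu hu2 N hI
  have hstop : hRowStep X F u (hRowRun X F u N y) = none := by
    rcases hend with h | h
    · -- all the fuel was used: the walker would be above `H`
      exfalso
      subst h
      have hyX := hInv.1
      have h1 := hH _ hyX
      rw [hrun, inner_add_left, inner_smul_left] at h1
      simp only [RCLike.conj_to_real] at h1
      have h2 : r * (n : ℝ) ≤ (n : ℝ) * ⟪F u, z⟫_ℝ := by
        rw [mul_comm]; exact mul_le_mul_of_nonneg_left hrise (Nat.cast_nonneg n)
      linarith
    · exact h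
  exact ⟨n, hn, hrun, hInv.1, hstop, hRow_end_le_eleven hX hu hu2 hInv hstop (hcert _).1 (hcert _).2⟩

end Summit.Ventures.Crystal3D.Theorems

end
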